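import Summits.ValiantsHypothesis.ValiantsHypothesis.Theorems.GrenetZeonDualUnipotentThreeHalvesSlowCoreLedger

/-!
# Row r3 — the NIL-COUPLING MOVE as a certified `SlowCore.Ledger` / `SlowCore.RelCert` provider
# (crux workfile for `GrenetZeon.DualUnipotentThreeHalves` = stmt-ValiantsHypothesis-24318; val-idea-26 g6, lens (a) «nilpotent-subspace structure theory»)

Line of record `Lines/slow_core.lean` rev 3 @3b0d486a3202 (LEAD val-port-2 g3; crit-7 REGISTRATION PASS 00:07:12Z) reduces the crux IN THE KERNEL to
ONE research statement, (c) ✓-typed `SlowCore.LongMassSlowLawInv` (every IRREDUCIBLE affine nilpotent pencil `B : AffMat n b` has a certificate of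
price `≤ c·√n·b`).  crit-7's rows table for the (c)-seat (V27 §3 / V30 §C / V32 §C) lists the certified MOVES a price calculus may use:
r1 flag ✓ (`TriangularRow.ledger_of_flagAdapted`), r2 triangularisable value space ✓ (`TriangularRow.relCert_of_values_triangularisable`),
**r3 nil-coupling — OPEN (M)**, r4 gauge ✓ (`GaugeRow`), r4′ flag floor (paper ✓, F1+F2 kernel `CornerTransfer`), r5, r6.  THIS FILE CLOSES r3.

THE MOVE (crit-7 V26 §6, the E♮(n) row, on paper).  Cut the coordinates into TOP and BOTTOM; write the line matrix `Y(s) = [[u, a], [b, z]]`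
(`u` top block, `z` bottom block, `a` glue top→bottom columns, `b` the RETURN bottom→top).  If the return never sees the glue through powers of the
top block — `b · uⁱ · a = 0` for every `i` (NIL-COUPLING; for E♮: `c_out · u(s)ⁱ · c_in = 0` because slot `s ∈ [2, h−2]` of `U_{h,k}` is never
read, ✓ `InvisibleCoupling`) — then every power of `Y` contains AT MOST ONE return letter (`add_pow_of_sandwich`, the binomial collapse behind
✓ `InvisibleCoupling.invisibleCoupling_holds`, here as an IDENTITY for all powers, not just nilpotency):
  `Y^L = [[u^L + Σ_p X_p·b·u^{L−1−p},  X_L], [Σ_p z^p·b·u^{L−1−p},  z^L]]`,  `X_p = Σ_{i<p} uⁱ·a·z^{p−1−i}`   (`pow_eq_of_nilCoupling`),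
so WINDOW DEGREES ADD: if the powers of `u` have `s`-degree `≤ k₁` and those of `z` `≤ k₂` (exponents `≤ L`) and the entries are affine, every
entry of `Y^L` has degree `≤ 2k₁ + k₂ + 2` (`totalDegree_pow_le_of_nilCoupling`; top crossed at most twice, bottom once, the letters `a`, `b`
once each).  Compare ✓ `SlowCore.absorb_tower` (no return, `b = 0`): `k₁ + k₂ + 1`.  So an IRREDUCIBLE constituent that is a nil-coupled sum is
no pricier than the block sum — «irreducibility is free» (idea-29 g5 / V26) now has its POSITIVE half in the kernel: the coupling that makes E♮
irreducible costs `+k₁ + 1` in the ledger, never a ratio.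

CONTENTS (0 sorry; Mathlib + ✓ `Theorems.…SlowCoreLedger` only; conclusions are ✓ p680269 `SlowCore.Ledger` / `SlowCore.RelCert` BY NAME):
§1 `add_pow_of_sandwich` — `E·Xᵃ·E = 0 ∀a ⇒ (X+E)^L = X^L + Σ_{p<L} X^p E X^{L−1−p}` (any semiring).
§2 `glueSum`, `upper_pow` (powers of `[[u,a],[0,z]]`), `mul_glueSum_eq_zero`, `sandwich_eq_zero`, `sum_fromBlocks`, ★ `pow_eq_of_nilCoupling`
   (any commutative ring, any finite index types `ι ⊕ κ`).
§3 `totalDegree_mul_apply_le`, `totalDegree_sum_apply_le`, `totalDegree_glueSum_le`, ★ `totalDegree_pow_le_of_nilCoupling` (Sum-indexed).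
§4 `submatrix_equiv_pow`, ★ `totalDegree_pow_le_of_nilCoupling_cut` — the same for a predicate cut `top : Fin m → Prop` (blocks = `Matrix.toBlock`,
   the shape of ✓ `SlowCore.absorb`), via `Equiv.sumCompl`.
§5 `eval_lineSubst`, ★ `coupling_of_pointwise` (the identity `b·uⁱ·a = 0` on every VALUE `N(y)` ⇒ on every line pull-back `N(x + s v)` as a
   polynomial identity, ✓ `MvPolynomial.funext` — so the hypothesis is checkable on values), ★★ `ledger_of_nilCoupling` (r3 as a `SlowCore.Ledger`
   provider on a direction space `K`), ★ `ledger_of_nilCoupling_blocks` (the diagonal blocks priced by their OWN `SlowCore.Ledger`s on the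
   sub-pencils `N.submatrix …`, common `K`), `relCert_of_nilCoupling` (price `n·(2k₁ + k₂ + 2) + codim K`).
READING FOR E♮(n) (V26 §6): `top` = the U-slots, `K` = directions freezing band and coupling (`k₂ = 0`, codim `D_Z + 1`), U-line pointwise short of
index `h` ⇒ `k₁ = h − 1` ⇒ ledger `2h` (V26's hand count `2h − 2`; immaterial) ⇒ price `2hn + D_Z + 1 ≤ c√n·m` ✓ as V27 §3 books it.

CELL DATUM USED (val-heavytop-census, read 00:10Z): GRID v0.7 TRANSFER NOTE «✓ cells transfer to power currency kernel-composably, ✗ cells are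
flag-expensive only — none is power-expensive» and X8/E♮ (Slow by cancellation): r3 is the kernel form of the one composability the note relies on
for COUPLED (irreducible) sums; with r1 r2 r4 ✓ the calculus now has all four certified moves of V27 §3 by name on `SlowCore.Ledger`.

HONEST FRAMING: an INSTRUMENT row (M-tier) named by the registered skeleton's menu and the critic's rows table; no law is asserted and nothing here
is claimed new (V26 §6 in the kernel, generalised from nilpotency to all powers and to arbitrary window degrees).  (c) `LongMassSlowLawInv` / S3
`SlowPlane` / R2ᵖ / 24318 / 8062 OPEN; `VP ≠ VNP` NOT proved.  0 sorry.
-/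

set_option linter.dupNamespace false
set_option autoImplicit false

noncomputable section

namespace Summit.ValiantsHypothesis.ValiantsHypothesis.Cruxes.DualUnipotentThreeHalves.NilCouplingRow

open MvPolynomial Matrix
open scoped BigOperators
open Summit.ValiantsHypothesis.ValiantsHypothesis.Cruxes.TwoDimCoefficients.DimTwoCases (AffMat IsAffine)
open Summit.ValiantsHypothesis.ValiantsHypothesis.Theorems.GrenetZeon.RadicalSplit (lineSubst)
open Summit.ValiantsHypothesis.ValiantsHypothesis.Theorems.GrenetZeon.SlowCore (Ledger RelCert totalDegree_lineSubst_le_one)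

/-! ## §1 The collapse identity (abstract semiring) -/

section Collapse

variable {S : Type*} [Semiring S]

/-- **COLLAPSE.**  If `E` never sees itself through powers of `X` (`E·Xᵃ·E = 0` for all `a`), then every power of `X + E` contains at most
one letter `E`:  `(X + E)^L = X^L + Σ_{p<L} X^p · E · X^{L-1-p}`. [folklore binomial collapse; the mechanism of `InvisibleCoupling.lean`] -/
theorem add_pow_of_sandwich (X E : S) (hE : ∀ a : ℕ, E * X ^ a * E = 0) :
    ∀ L : ℕ, (X + E) ^ L = X ^ L + ∑ p ∈ Finset.range L, X ^ p * E * X ^ (L - 1 - p)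
  | 0 => by simp
  | L + 1 => by
      have h1 : ∑ p ∈ Finset.range L, X ^ p * E * X ^ (L - 1 - p) * X
          = ∑ p ∈ Finset.range L, X ^ p * E * X ^ (L + 1 - 1 - p) := by
        refine Finset.sum_congr rfl fun p hp => ?_
        have hp' : p < L := Finset.mem_range.mp hp
        rw [mul_assoc, ← pow_succ, show L - 1 - p + 1 = L + 1 - 1 - p by omega]
      have h2 : ∑ p ∈ Finset.range L, X ^ p * E * X ^ (L - 1 - p) * E = 0 := by
        refine Finset.sum_eq_zero fun p _ => ?_
        rw [mul_assoc (X ^ p) E, mul_assoc (X ^ p), hE, mul_zero]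
      have h3 : X ^ L * E = X ^ L * E * X ^ (L + 1 - 1 - L) := by
        rw [show L + 1 - 1 - L = 0 by omega, pow_zero, mul_one]
      rw [pow_succ, add_pow_of_sandwich X E hE L, add_mul, mul_add, mul_add, Finset.sum_mul, Finset.sum_mul, h1, h2,
        add_zero, ← pow_succ, Finset.sum_range_succ, ← h3, add_assoc, add_comm (X ^ L * E)]

end Collapse

/-! ## §2 Block bookkeeping for a nil-coupled `2 × 2` block matrix (commutative ring of scalars) -/

section Blocks

variable {ι κ : Type*} [Fintype ι] [Fintype κ] [DecidableEq ι] [DecidableEq κ] {R : Type*} [CommRing R]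

/-- The glue block of the `p`-th power of the block-upper matrix `[[u, a], [0, z]]`:  `Σ_{i<p} uⁱ · a · z^{p-1-i}`. -/
def glueSum (u : Matrix ι ι R) (a : Matrix ι κ R) (z : Matrix κ κ R) (p : ℕ) : Matrix ι κ R :=
  ∑ i ∈ Finset.range p, u ^ i * a * z ^ (p - 1 - i)

theorem glueSum_succ (u : Matrix ι ι R) (a : Matrix ι κ R) (z : Matrix κ κ R) (p : ℕ) :
    glueSum u a z (p + 1) = u ^ p * a + glueSum u a z p * z := by
  unfold glueSum
  rw [Finset.sum_range_succ, Matrix.sum_mul, show p + 1 - 1 - p = 0 by omega, pow_zero, Matrix.mul_one, add_comm]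
  congr 1
  refine Finset.sum_congr rfl fun i hi => ?_
  have hi' : i < p := Finset.mem_range.mp hi
  rw [Matrix.mul_assoc (u ^ i * a) (z ^ (p - 1 - i)) z, ← pow_succ, show p - 1 - i + 1 = p + 1 - 1 - i by omega]

/-- Powers of a block-upper matrix. [folklore] -/
theorem upper_pow (u : Matrix ι ι R) (a : Matrix ι κ R) (z : Matrix κ κ R) :
    ∀ L : ℕ, (fromBlocks u a 0 z) ^ L = fromBlocks (u ^ L) (glueSum u a z L) 0 (z ^ L)
  | 0 => by
      simp [glueSum]
  | L + 1 => by
      rw [pow_succ, upper_pow u a z L, fromBlocks_multiply, glueSum_succ, pow_succ, pow_succ]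
      simp

/-- Nil-coupling kills the return against every glue block. -/
theorem mul_glueSum_eq_zero (u : Matrix ι ι R) (a : Matrix ι κ R) (b : Matrix κ ι R) (z : Matrix κ κ R)
    (hc : ∀ i : ℕ, b * u ^ i * a = 0) (p : ℕ) : b * glueSum u a z p = 0 := by
  unfold glueSum
  rw [Matrix.mul_sum]
  refine Finset.sum_eq_zero fun i _ => ?_
  rw [← Matrix.mul_assoc, ← Matrix.mul_assoc, hc, Matrix.zero_mul]

/-- The return `E = [[0,0],[b,0]]` never sees itself through the block-upper part `X = [[u,a],[0,z]]`. -/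
theorem sandwich_eq_zero (u : Matrix ι ι R) (a : Matrix ι κ R) (b : Matrix κ ι R) (z : Matrix κ κ R)
    (hc : ∀ i : ℕ, b * u ^ i * a = 0) (q : ℕ) :
    fromBlocks 0 0 b 0 * (fromBlocks u a 0 z) ^ q * fromBlocks 0 0 b 0 = (0 : Matrix (ι ⊕ κ) (ι ⊕ κ) R) := by
  rw [upper_pow, fromBlocks_multiply, fromBlocks_multiply]
  simp [mul_glueSum_eq_zero u a b z hc]

omit [Fintype ι] [Fintype κ] [DecidableEq ι] [DecidableEq κ] in
/-- Finite sums of block matrices, blockwise. -/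
theorem sum_fromBlocks (s : Finset ℕ) (A : ℕ → Matrix ι ι R) (B : ℕ → Matrix ι κ R) (C : ℕ → Matrix κ ι R)
    (D : ℕ → Matrix κ κ R) :
    ∑ p ∈ s, fromBlocks (A p) (B p) (C p) (D p) = fromBlocks (∑ p ∈ s, A p) (∑ p ∈ s, B p) (∑ p ∈ s, C p) (∑ p ∈ s, D p) := by
  induction s using Finset.cons_induction with
  | empty => simp
  | cons p s hp ih => rw [Finset.sum_cons, Finset.sum_cons, Finset.sum_cons, Finset.sum_cons, Finset.sum_cons, ih, fromBlocks_add]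

/-- ★ **POWERS OF A NIL-COUPLED BLOCK MATRIX.**  If the return `b` never sees the glue `a` through powers of the top block `u`
(`b·uⁱ·a = 0` for all `i`), then every power of `Y = [[u, a], [b, z]]` has at most ONE return letter:
`Y^L = [[u^L + Σ_p X_p·b·u^{L-1-p},  X_L], [Σ_p z^p·b·u^{L-1-p},  z^L]]` with `X_p = Σ_{i<p} uⁱ a z^{p-1-i}`. [this file] -/
theorem pow_eq_of_nilCoupling (u : Matrix ι ι R) (a : Matrix ι κ R) (b : Matrix κ ι R) (z : Matrix κ κ R)
    (hc : ∀ i : ℕ, b * u ^ i * a = 0) (L : ℕ) :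
    (fromBlocks u a b z) ^ L =
      fromBlocks (u ^ L + ∑ p ∈ Finset.range L, glueSum u a z p * b * u ^ (L - 1 - p)) (glueSum u a z L)
        (∑ p ∈ Finset.range L, z ^ p * b * u ^ (L - 1 - p)) (z ^ L) := by
  have hsplit : fromBlocks u a b z = fromBlocks u a 0 z + fromBlocks 0 0 b 0 := by
    rw [fromBlocks_add]; simp
  have hbX1 : ∀ p q : ℕ, glueSum u a z p * b * glueSum u a z q = 0 := by
    intro p q
    rw [Matrix.mul_assoc, mul_glueSum_eq_zero u a b z hc, Matrix.mul_zero]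
  have hbX2 : ∀ p q : ℕ, z ^ p * b * glueSum u a z q = 0 := by
    intro p q
    rw [Matrix.mul_assoc, mul_glueSum_eq_zero u a b z hc, Matrix.mul_zero]
  have hterm : ∀ p q : ℕ, (fromBlocks u a 0 z) ^ p * fromBlocks 0 0 b 0 * (fromBlocks u a 0 z) ^ q
      = fromBlocks (glueSum u a z p * b * u ^ q) 0 (z ^ p * b * u ^ q) 0 := by
    intro p q
    rw [upper_pow, upper_pow, fromBlocks_multiply, fromBlocks_multiply]
    simp [hbX1, hbX2]
  rw [hsplit, add_pow_of_sandwich _ _ (sandwich_eq_zero u a b z hc) L, upper_pow]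
  simp_rw [hterm]
  rw [sum_fromBlocks, fromBlocks_add]
  simp

end Blocks

/-! ## §3 Degrees (one-variable polynomial scalars, the line currency of `SlowCore.Ledger`) -/

section Degrees

/-- Entrywise degree of a product. [folklore] -/
theorem totalDegree_mul_apply_le {α β γ : Type*} [Fintype β] (A : Matrix α β (MvPolynomial (Fin 1) ℂ))
    (B : Matrix β γ (MvPolynomial (Fin 1) ℂ)) {dA dB : ℕ}
    (hA : ∀ r c, (A r c).totalDegree ≤ dA) (hB : ∀ r c, (B r c).totalDegree ≤ dB) (r : α) (c : γ) :
    ((A * B) r c).totalDegree ≤ dA + dB := by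
  rw [Matrix.mul_apply]
  refine (totalDegree_finsetSum _ _).trans (Finset.sup_le fun l _ => ?_)
  exact (totalDegree_mul _ _).trans (Nat.add_le_add (hA r l) (hB l c))

/-- Entrywise degree of a finite sum. [folklore] -/
theorem totalDegree_sum_apply_le {α β : Type*} (s : Finset ℕ) (F : ℕ → Matrix α β (MvPolynomial (Fin 1) ℂ)) {d : ℕ}
    (hF : ∀ p ∈ s, ∀ r c, (F p r c).totalDegree ≤ d) (r : α) (c : β) :
    ((∑ p ∈ s, F p) r c).totalDegree ≤ d := by
  rw [Matrix.sum_apply]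
  exact (totalDegree_finsetSum _ _).trans (Finset.sup_le fun p hp => hF p hp r c)

variable {ι κ : Type*} [Fintype ι] [Fintype κ] [DecidableEq ι] [DecidableEq κ]

/-- Degree of the glue blocks from the WINDOW degrees of the two diagonal blocks. -/
theorem totalDegree_glueSum_le (u : Matrix ι ι (MvPolynomial (Fin 1) ℂ)) (a : Matrix ι κ (MvPolynomial (Fin 1) ℂ))
    (z : Matrix κ κ (MvPolynomial (Fin 1) ℂ)) {k₁ k₂ d L : ℕ}
    (hu : ∀ i, i ≤ L → ∀ r c, ((u ^ i) r c).totalDegree ≤ k₁)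
    (hz : ∀ i, i ≤ L → ∀ r c, ((z ^ i) r c).totalDegree ≤ k₂)
    (ha : ∀ r c, (a r c).totalDegree ≤ d) (p : ℕ) (hp : p ≤ L + 1) (r : ι) (c : κ) :
    ((glueSum u a z p) r c).totalDegree ≤ k₁ + d + k₂ := by
  unfold glueSum
  refine totalDegree_sum_apply_le _ _ (fun i hi r c => ?_) r c
  have hi' : i < p := Finset.mem_range.mp hi
  exact totalDegree_mul_apply_le _ _ (totalDegree_mul_apply_le _ _ (hu i (by omega)) ha) (hz (p - 1 - i) (by omega)) r c

/-- ★ **NIL-COUPLING DEGREE BOUND** (Sum-indexed).  For an affine one-variable matrix `Y = [[u,a],[b,z]]` with `b·uⁱ·a = 0` for all `i`,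
window degrees `k₁` (powers of `u`) and `k₂` (powers of `z`) up to the exponent `L` give EVERY entry of `Y^L` degree `≤ 2k₁ + k₂ + 2`:
certificates of nil-coupled blocks ADD (the top block is crossed at most twice, the bottom block once, the two affine letters `a`, `b` once each).
[this file] -/
theorem totalDegree_pow_le_of_nilCoupling (Y : Matrix (ι ⊕ κ) (ι ⊕ κ) (MvPolynomial (Fin 1) ℂ)) (k₁ k₂ L : ℕ)
    (haff : ∀ r c, (Y r c).totalDegree ≤ 1)
    (hcoup : ∀ i : ℕ, Y.toBlocks₂₁ * Y.toBlocks₁₁ ^ i * Y.toBlocks₁₂ = 0)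
    (htop : ∀ i, i ≤ L → ∀ r c, ((Y.toBlocks₁₁ ^ i) r c).totalDegree ≤ k₁)
    (hbot : ∀ i, i ≤ L → ∀ r c, ((Y.toBlocks₂₂ ^ i) r c).totalDegree ≤ k₂) :
    ∀ r c, ((Y ^ L) r c).totalDegree ≤ 2 * k₁ + k₂ + 2 := by
  have hY : Y = fromBlocks Y.toBlocks₁₁ Y.toBlocks₁₂ Y.toBlocks₂₁ Y.toBlocks₂₂ := (fromBlocks_toBlocks Y).symm
  have ha : ∀ r c, (Y.toBlocks₁₂ r c).totalDegree ≤ 1 := fun r c => haff (Sum.inl r) (Sum.inr c)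
  have hb : ∀ r c, (Y.toBlocks₂₁ r c).totalDegree ≤ 1 := fun r c => haff (Sum.inr r) (Sum.inl c)
  rw [hY, pow_eq_of_nilCoupling _ _ _ _ hcoup L]
  rintro (r | r) (c | c)
  · rw [fromBlocks_apply₁₁, Matrix.add_apply]
    refine (totalDegree_add _ _).trans (max_le ((htop L le_rfl r c).trans (by omega)) ?_)
    refine totalDegree_sum_apply_le _ _ (fun p hp r c => ?_) r c
    have hp' : p < L := Finset.mem_range.mp hp
    have := totalDegree_mul_apply_le _ _
      (totalDegree_mul_apply_le _ _ (totalDegree_glueSum_le _ _ _ htop hbot ha p (by omega)) hb)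
      (htop (L - 1 - p) (by omega)) r c
    omega
  · rw [fromBlocks_apply₁₂]
    exact (totalDegree_glueSum_le _ _ _ htop hbot ha L (by omega) r c).trans (by omega)
  · rw [fromBlocks_apply₂₁]
    refine totalDegree_sum_apply_le _ _ (fun p hp r c => ?_) r c
    have hp' : p < L := Finset.mem_range.mp hp
    have := totalDegree_mul_apply_le _ _ (totalDegree_mul_apply_le _ _ (hbot p (by omega)) hb)
      (htop (L - 1 - p) (by omega)) r c
    omega
  · rw [fromBlocks_apply₂₂]
    exact (hbot L le_rfl r c).trans (by omega)

end Degrees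

/-! ## §4 The same for a predicate cut `top : Fin m → Prop` (the shape of ✓ `SlowCore.absorb` / `absorb_tower`) -/

section Cut

/-- Reindexing along an equivalence commutes with powers. [folklore] -/
theorem submatrix_equiv_pow {α β : Type*} [Fintype α] [Fintype β] [DecidableEq α] [DecidableEq β] {R : Type*} [CommRing R]
    (M : Matrix β β R) (e : α ≃ β) : ∀ L : ℕ, (M.submatrix e e) ^ L = (M ^ L).submatrix e e
  | 0 => by rw [pow_zero, pow_zero, Matrix.submatrix_one_equiv]
  | L + 1 => by rw [pow_succ, pow_succ, submatrix_equiv_pow M e L, Matrix.submatrix_mul_equiv]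

variable {m : ℕ} (top : Fin m → Prop) [DecidablePred top]

/-- ★ **NIL-COUPLING DEGREE BOUND, cut form.**  `M` affine one-variable; TOP block `u = M|_{top×top}`, BOTTOM block `z`, glue `a = M|_{top×bot}`,
RETURN `b = M|_{bot×top}` with `b·uⁱ·a = 0` for every `i`; window degrees `k₁` (powers of `u`), `k₂` (powers of `z`) up to `L`
⇒ every entry of `M^L` has degree `≤ 2k₁ + k₂ + 2`.  Compare ✓ `SlowCore.absorb_tower` (`b = 0`: `k₁ + k₂ + 1`). [this file] -/
theorem totalDegree_pow_le_of_nilCoupling_cut (M : Matrix (Fin m) (Fin m) (MvPolynomial (Fin 1) ℂ)) (k₁ k₂ L : ℕ)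
    (haff : ∀ i j, (M i j).totalDegree ≤ 1)
    (hcoup : ∀ i : ℕ, M.toBlock (fun a => ¬ top a) top * M.toBlock top top ^ i * M.toBlock top (fun a => ¬ top a) = 0)
    (htop : ∀ i, i ≤ L → ∀ r c, ((M.toBlock top top ^ i) r c).totalDegree ≤ k₁)
    (hbot : ∀ i, i ≤ L → ∀ r c, ((M.toBlock (fun a => ¬ top a) (fun a => ¬ top a) ^ i) r c).totalDegree ≤ k₂) :
    ∀ i j, ((M ^ L) i j).totalDegree ≤ 2 * k₁ + k₂ + 2 := by
  set e := Equiv.sumCompl top with he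
  set Y : Matrix ({a // top a} ⊕ {a // ¬ top a}) ({a // top a} ⊕ {a // ¬ top a}) (MvPolynomial (Fin 1) ℂ) :=
    M.submatrix e e with hY
  have h11 : Y.toBlocks₁₁ = M.toBlock top top := by ext r c; rfl
  have h12 : Y.toBlocks₁₂ = M.toBlock top (fun a => ¬ top a) := by ext r c; rfl
  have h21 : Y.toBlocks₂₁ = M.toBlock (fun a => ¬ top a) top := by ext r c; rfl
  have h22 : Y.toBlocks₂₂ = M.toBlock (fun a => ¬ top a) (fun a => ¬ top a) := by ext r c; rfl
  have hYdeg := totalDegree_pow_le_of_nilCoupling Y k₁ k₂ L (fun r c => haff _ _)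
    (by rw [h11, h12, h21]; exact hcoup) (by rw [h11]; exact htop) (by rw [h22]; exact hbot)
  intro i j
  have h := hYdeg (e.symm i) (e.symm j)
  rwa [hY, submatrix_equiv_pow, Matrix.submatrix_apply, Equiv.apply_symm_apply, Equiv.apply_symm_apply] at h

end Cut

/-! ## §5 Row r3 at the PENCIL level: `SlowCore.Ledger` / `SlowCore.RelCert` providers BY NAME -/

section Pencil

variable {n m : ℕ}

/-- Evaluating a line pull-back at `s = t` is evaluating the pencil at the point `x + t·v`. [folklore] -/
theorem eval_lineSubst {σ : Type*} (x v : σ → ℂ) (t : Fin 1 → ℂ) (f : MvPolynomial σ ℂ) :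
    eval t (lineSubst x v f) = eval (fun c => x c + t 0 * v c) f := by
  have h : (eval t).comp (lineSubst x v : MvPolynomial σ ℂ →ₐ[ℂ] MvPolynomial (Fin 1) ℂ).toRingHom
      = eval (fun c => x c + t 0 * v c) := by
    refine MvPolynomial.ringHom_ext (fun r => ?_) (fun c => ?_)
    · simp [lineSubst]
    · simp [lineSubst, mul_comm]
  exact RingHom.congr_fun h f

/-- **POINTWISE ⇒ ALONG LINES.**  If the nil-coupling identity `b·uⁱ·a = 0` holds for every VALUE `N(y)` of the pencil, it holds for the
pull-back `N(x + s v)` as an identity of polynomial matrices in `s` (a polynomial vanishing at every point of `ℂ` is zero, ✓ `MvPolynomial.funext`).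
So the coupling hypothesis of `ledger_of_nilCoupling` is checkable on values. [this file] -/
theorem coupling_of_pointwise (N : AffMat n m) (top : Fin m → Prop) [DecidablePred top]
    (hpt : ∀ y : Fin n × Fin n → ℂ, ∀ i : ℕ,
      (N.map (eval y)).toBlock (fun a => ¬ top a) top * (N.map (eval y)).toBlock top top ^ i *
        (N.map (eval y)).toBlock top (fun a => ¬ top a) = 0)
    (x v : Fin n × Fin n → ℂ) (i : ℕ) :
    (N.map (lineSubst x v)).toBlock (fun a => ¬ top a) top * (N.map (lineSubst x v)).toBlock top top ^ i *
      (N.map (lineSubst x v)).toBlock top (fun a => ¬ top a) = 0 := by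
  refine Matrix.ext fun r c => ?_
  apply MvPolynomial.funext
  intro t
  rw [Matrix.zero_apply, map_zero]
  set A : Matrix (Fin m) (Fin m) (MvPolynomial (Fin 1) ℂ) := N.map (lineSubst x v) with hA
  have hmap : eval t ((A.toBlock (fun a => ¬ top a) top * A.toBlock top top ^ i * A.toBlock top (fun a => ¬ top a)) r c)
      = ((A.map (eval t)).toBlock (fun a => ¬ top a) top * (A.map (eval t)).toBlock top top ^ i *
          (A.map (eval t)).toBlock top (fun a => ¬ top a)) r c := by
    have e1 : ∀ (p q : Fin m → Prop), (A.map (eval t)).toBlock p q = (A.toBlock p q).map (eval t) := fun p q => rfl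
    rw [e1, e1, e1, ← Matrix.map_pow, ← Matrix.map_mul, ← Matrix.map_mul, Matrix.map_apply]
  have hval : A.map (eval t) = N.map (eval fun c => x c + t 0 * v c) := by
    rw [hA, Matrix.map_map]
    ext p q
    rw [Matrix.map_apply, Matrix.map_apply, Function.comp_apply, eval_lineSubst]
  rw [hmap, hval, hpt]
  rfl

/-- ★ **ROW r3 — THE NIL-COUPLING MOVE as a `SlowCore.Ledger` provider.**  Along every line `x + s v`, `v ∈ K`: the return block never sees the
glue block through powers of the top block (`b·uⁱ·a = 0`), the TOP block's own powers have window degree `≤ k₁` and the BOTTOM block's `≤ k₂`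
(exponents `≤ n − 1`) ⇒ `(K, 2k₁ + k₂ + 2)` is a whole-pencil ledger entry.  The E♮(n) row of crit-7 V26 §6 / V27 §3 (r3) in the kernel:
freeze band and coupling (`k₂ = 0`), U-line of window `k₁ = h − 1` ⇒ every power has degree `≤ 2h`. [this file; V26 §6 (paper)] -/
theorem ledger_of_nilCoupling (N : AffMat n m) (hN : IsAffine N) (top : Fin m → Prop) [DecidablePred top]
    (K : Submodule ℂ (Fin n × Fin n → ℂ)) (k₁ k₂ : ℕ)
    (hcoup : ∀ x v : Fin n × Fin n → ℂ, v ∈ K → ∀ i : ℕ,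
      (N.map (lineSubst x v)).toBlock (fun a => ¬ top a) top * (N.map (lineSubst x v)).toBlock top top ^ i *
        (N.map (lineSubst x v)).toBlock top (fun a => ¬ top a) = 0)
    (htop : ∀ x v : Fin n × Fin n → ℂ, v ∈ K → ∀ i, i ≤ n - 1 → ∀ r c,
      (((N.map (lineSubst x v)).toBlock top top ^ i) r c).totalDegree ≤ k₁)
    (hbot : ∀ x v : Fin n × Fin n → ℂ, v ∈ K → ∀ i, i ≤ n - 1 → ∀ r c,
      (((N.map (lineSubst x v)).toBlock (fun a => ¬ top a) (fun a => ¬ top a) ^ i) r c).totalDegree ≤ k₂) :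
    Ledger n m N (fun _ => True) K (2 * k₁ + k₂ + 2) := by
  intro x v hv b hb i j _ _
  exact totalDegree_pow_le_of_nilCoupling_cut top _ k₁ k₂ b
    (fun i j => by rw [Matrix.map_apply]; exact totalDegree_lineSubst_le_one x v (hN i j))
    (hcoup x v hv) (fun i hi => htop x v hv i (hi.trans hb)) (fun i hi => hbot x v hv i (hi.trans hb)) i j

/-- ★ **ROW r3 with the diagonal blocks priced by their OWN ledgers.**  Enumerate the top coordinates by `Fin s` and the bottom ones by `Fin t`;
if the two diagonal SUB-PENCILS carry whole-pencil ledgers `(K, k₁)`, `(K, k₂)` on a COMMON direction space `K` along which the nil-coupling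
identity holds, the big pencil carries `(K, 2k₁ + k₂ + 2)`: under nil-coupling, certificates ADD (top counted twice). [this file] -/
theorem ledger_of_nilCoupling_blocks {s t : ℕ} (N : AffMat n m) (hN : IsAffine N) (top : Fin m → Prop) [DecidablePred top]
    (eT : {a // top a} ≃ Fin s) (eB : {a // ¬ top a} ≃ Fin t) (K : Submodule ℂ (Fin n × Fin n → ℂ)) (k₁ k₂ : ℕ)
    (hcoup : ∀ x v : Fin n × Fin n → ℂ, v ∈ K → ∀ i : ℕ,
      (N.map (lineSubst x v)).toBlock (fun a => ¬ top a) top * (N.map (lineSubst x v)).toBlock top top ^ i *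
        (N.map (lineSubst x v)).toBlock top (fun a => ¬ top a) = 0)
    (htop : Ledger n s (N.submatrix (fun q => ((eT.symm q : {a // top a}) : Fin m)) (fun q => ((eT.symm q : {a // top a}) : Fin m)))
      (fun _ => True) K k₁)
    (hbot : Ledger n t (N.submatrix (fun q => ((eB.symm q : {a // ¬ top a}) : Fin m)) (fun q => ((eB.symm q : {a // ¬ top a}) : Fin m)))
      (fun _ => True) K k₂) :
    Ledger n m N (fun _ => True) K (2 * k₁ + k₂ + 2) := by
  refine ledger_of_nilCoupling N hN top K k₁ k₂ hcoup (fun x v hv i hi r c => ?_) (fun x v hv i hi r c => ?_)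
  · have h := htop x v hv i hi (eT r) (eT c) trivial trivial
    have hsub : (N.submatrix (fun q => ((eT.symm q : {a // top a}) : Fin m)) (fun q => ((eT.symm q : {a // top a}) : Fin m))).map
        (lineSubst x v) = ((N.map (lineSubst x v)).toBlock top top).submatrix eT.symm eT.symm := by
      ext p q; rfl
    rwa [hsub, submatrix_equiv_pow, Matrix.submatrix_apply, Equiv.symm_apply_apply, Equiv.symm_apply_apply] at h
  · have h := hbot x v hv i hi (eB r) (eB c) trivial trivial
    have hsub : (N.submatrix (fun q => ((eB.symm q : {a // ¬ top a}) : Fin m)) (fun q => ((eB.symm q : {a // ¬ top a}) : Fin m))).map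
        (lineSubst x v) = ((N.map (lineSubst x v)).toBlock (fun a => ¬ top a) (fun a => ¬ top a)).submatrix eB.symm eB.symm := by
      ext p q; rfl
    rwa [hsub, submatrix_equiv_pow, Matrix.submatrix_apply, Equiv.symm_apply_apply, Equiv.symm_apply_apply] at h

/-- **PRICE FORM.**  Row r3 as a `SlowCore.RelCert` provider: price `n·(2k₁ + k₂ + 2) + codim K`. [this file] -/
theorem relCert_of_nilCoupling (N : AffMat n m) (hN : IsAffine N) (top : Fin m → Prop) [DecidablePred top]
    (K : Submodule ℂ (Fin n × Fin n → ℂ)) (k₁ k₂ P : ℕ)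
    (hcoup : ∀ x v : Fin n × Fin n → ℂ, v ∈ K → ∀ i : ℕ,
      (N.map (lineSubst x v)).toBlock (fun a => ¬ top a) top * (N.map (lineSubst x v)).toBlock top top ^ i *
        (N.map (lineSubst x v)).toBlock top (fun a => ¬ top a) = 0)
    (htop : ∀ x v : Fin n × Fin n → ℂ, v ∈ K → ∀ i, i ≤ n - 1 → ∀ r c,
      (((N.map (lineSubst x v)).toBlock top top ^ i) r c).totalDegree ≤ k₁)
    (hbot : ∀ x v : Fin n × Fin n → ℂ, v ∈ K → ∀ i, i ≤ n - 1 → ∀ r c,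
      (((N.map (lineSubst x v)).toBlock (fun a => ¬ top a) (fun a => ¬ top a) ^ i) r c).totalDegree ≤ k₂)
    (hP : n * (2 * k₁ + k₂ + 2) + (n * n - Module.finrank ℂ K) ≤ P) :
    RelCert n m N P :=
  ⟨K, 2 * k₁ + k₂ + 2, ledger_of_nilCoupling N hN top K k₁ k₂ hcoup htop hbot, hP⟩

end Pencil

end Summit.ValiantsHypothesis.ValiantsHypothesis.Cruxes.DualUnipotentThreeHalves.NilCouplingRow

end
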